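import Mathlib
import Literature.NumberTheory.Transcendental.KZProduct
import Literature.NumberTheory.Transcendental.KZProductIdeal
import Literature.NumberTheory.Transcendental.KZVolumeConjectureProofs
import Summits.KontsevichZagierPeriods.KontsevichZagierPeriods.Theorems.SoloInformedVolumeLadder
import Summits.KontsevichZagierPeriods.KontsevichZagierPeriods.Theorems.SoloInformedKummerBox
import Summits.KontsevichZagierPeriods.KontsevichZagierPeriods.Theorems.SoloInformedTorusInstance
import HarnessLib
import HarnessLib.Audit

/-!
# SoloInformed — the logical shape of the Theorem II instance

Two named statements about the instance `T₀ = {(x² + y² − 2)² + z² ≤ 1}` versus the Kummer box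
`B(2,3) = {1 ≤ x ≤ 2, 1 ≤ y ≤ 3, 0 ≤ z, xyz ≤ 1}` (`SoloInformedTorusInstance`, `SoloInformedKummerBox`):

* `SoloInformedTorusBoxNoRelation` — "no relation in the calculus": for all `p, q ≥ 1`,
  `p·[D̄]·[D̄] − q·[L₂]·[L₃] ∉ relations`. This is what the residency paper proves ON PAPER (§3: Theorem A,
  moves ⇒ equality of effective formal periods, plus the period torsor of `⟨K₂ ⊕ K₃⟩`); it is typed here
  as a named statement used as a hypothesis, never asserted.
* `SoloInformedC4EW23` — the case `(2, 3)` of the weak four-exponentials conjecture: for all `p, q ≥ 1`,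
  `p·π² ≠ q·log 2·log 3` (open; Nesterenko–Philippon (eds.), LNM 1752, Ch. 2 §4.1 (C4EW); Waldschmidt's
  survey in Alladi (ed.), *Surveys in Number Theory* (2008), Conjecture 12, rank-one case
  `M = ((iπ, log 2), (−q log 3, p iπ))`).

**Theorems (KERNEL).** (1) `SoloInformedC4EW23 → SoloInformedTorusBoxNoRelation` unconditionally (a relation
in the calculus forces the numerical relation, by `eval`); (2) `SoloInformedVolumeRung 3 →
SoloInformedTorusBoxNoRelation → SoloInformedC4EW23` (`soloInformed_rung_three_torus_box`); hence
(3) granting volume rung `3` the motivic non-relation and the transcendence statement are EQUIVALENT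
(`soloInformed_rung_three_noRelation_iff_c4ew`). Theorem II of the paper is (2) with the hypothesis
`SoloInformedTorusBoxNoRelation` discharged on paper: `Rung_3 ⇒ (C4EW)(2,3)`.

Residency `solo-KontsevichZagierPeriods-informed` (PLAN.md, session s16).
References: M. Kontsevich, D. Zagier, *Periods* (2001), §1.2; Yu. Nesterenko, P. Philippon (eds.),
*Introduction to Algebraic Independence Theory*, LNM 1752 (2001), Ch. 2 §4.1–4.2.
-/

noncomputable section

namespace Summit.KontsevichZagierPeriods.KontsevichZagierPeriods.Theorems

open Literature.NumberTheory.Transcendental Literature.NumberTheory.Transcendental.KZ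

/-- **No relation in the calculus between `[D̄]·[D̄]` and `[L₂]·[L₃]`** (proved ON PAPER in the residency
paper, §3; typed here as a hypothesis): for `p, q ≥ 1`, `p·[D̄]·[D̄] − q·[L₂]·[L₃] ∉ relations`. -/
@[conjecture] def SoloInformedTorusBoxNoRelation : Prop :=
  ∀ p q : ℕ, p ≠ 0 → q ≠ 0 →
    p • (of piRep * of piRep) - q • (of (soloInformedKummerRep 2) * of (soloInformedKummerRep 3)) ∉ relations

/-- **The case `(2,3)` of the weak four-exponentials conjecture** (OPEN): `π²` and `log 2 · log 3` are
`ℚ`-linearly independent, in the form `p·π² ≠ q·(log 2·log 3)` for all `p, q ≥ 1` (both numbers are positive,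
so this is the full `ℚ`-linear independence). [Nesterenko–Philippon 2001, Ch. 2 §4.1 (C4EW)] -/
@[conjecture] def SoloInformedC4EW23 : Prop :=
  ∀ p q : ℕ, p ≠ 0 → q ≠ 0 → (p : ℝ) * Real.pi ^ 2 ≠ q * (Real.log 2 * Real.log 3)

/-- `eval` of the instance combination: `eval (p·[D̄]·[D̄] − q·[L₂]·[L₃]) = p·π² − q·log 2·log 3`. -/
theorem soloInformed_eval_torusBox_combination (p q : ℕ) :
    eval (p • (of piRep * of piRep) -
      q • (of (soloInformedKummerRep 2) * of (soloInformedKummerRep 3))) =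
      (p : ℝ) * Real.pi ^ 2 - q * (Real.log 2 * Real.log 3) := by
  rw [of_mul_of, of_mul_of, map_sub, map_nsmul, map_nsmul, eval_of, eval_of, IntegralRep.value_prod,
    IntegralRep.value_prod, piRep_value, soloInformed_value_kummerRep 2 (by norm_num),
    soloInformed_value_kummerRep 3 (by norm_num), nsmul_eq_mul, nsmul_eq_mul, sq]
  push_cast
  ring

/-- **(1)** The transcendence statement implies the non-relation, unconditionally: a relation in the
calculus is evaluated by `eval` (which kills `relations`) to the numerical relation. -/
theorem soloInformed_noRelation_of_c4ew (h : SoloInformedC4EW23) : SoloInformedTorusBoxNoRelation := by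
  intro p q hp hq hmem
  have h0 := eval_eq_zero_of_mem_relations hmem
  rw [soloInformed_eval_torusBox_combination] at h0
  exact h p q hp hq (by linarith)

/-- **(2)** Granting volume rung `3`, the non-relation implies the transcendence statement
(`soloInformed_rung_three_torus_box`: a numerical relation would be realised by equal-volume solids, hence
by moves). With `SoloInformedTorusBoxNoRelation` proved on paper this is Theorem II: `Rung_3 ⇒ (C4EW)(2,3)`. -/
theorem soloInformed_c4ew_of_rung_three_of_noRelation (h3 : SoloInformedVolumeRung 3)
    (hN : SoloInformedTorusBoxNoRelation) : SoloInformedC4EW23 :=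
  fun p q hp hq hrel => hN p q hp hq (soloInformed_rung_three_torus_box h3 p q hp hq hrel)

/-- **(3)** Granting volume rung `3`, the motivic non-relation and the transcendence statement are
equivalent. -/
theorem soloInformed_rung_three_noRelation_iff_c4ew (h3 : SoloInformedVolumeRung 3) :
    SoloInformedTorusBoxNoRelation ↔ SoloInformedC4EW23 :=
  ⟨soloInformed_c4ew_of_rung_three_of_noRelation h3, soloInformed_noRelation_of_c4ew⟩

/-- The contrapositive reading used in the paper's census: if volume rung `3` holds and `(C4EW)(2,3)`
FAILS, then the calculus itself relates `[D̄]·[D̄]` and `[L₂]·[L₃]` — a sequence of the four moves would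
carry a solid torus to a box under a hyperbolic surface. -/
theorem soloInformed_relation_of_rung_three_of_not_c4ew (h3 : SoloInformedVolumeRung 3)
    (hneg : ¬ SoloInformedC4EW23) :
    ∃ p q : ℕ, p ≠ 0 ∧ q ≠ 0 ∧
      p • (of piRep * of piRep) -
        q • (of (soloInformedKummerRep 2) * of (soloInformedKummerRep 3)) ∈ relations := by
  by_contra hcon
  exact hneg (soloInformed_c4ew_of_rung_three_of_noRelation h3 fun p q hp hq hmem =>
    hcon ⟨p, q, hp, hq, hmem⟩)

end Summit.KontsevichZagierPeriods.KontsevichZagierPeriods.Theorems
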